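import Literature.Analysis.FluidPDE.ClassicalSupStabilityForced
import HarnessLib

/-!
# Sup-norm stability of an unforced bounded classical solution under a small force, WITHOUT an
# a-priori bound on the forced solution (bootstrap form)

Analysis/FluidPDE proof file (theorems only; no definitions, no named facts, no `sorry`).
Companion of `ClassicalSupStabilityForced.lean`. There (`sup_stability_forced_free`) the forced
solution `u'` is compared with the unforced reference `u` under an A-PRIORI bound `‖u'‖ ≤ M'` that
enters the rate `exp (36 C₀² (M + M')² t / ν)`. Here that bound is produced by the estimate itself:
if the reference solution obeys `‖u‖ ≤ M` on `[0, T] × ℝ³`, the forced solution `u'` from a nearby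
datum is classical with finite energy and bounded by SOME constant on the slab (every classical
finite-energy solution from an `H^∞` datum is — `IsClassicalNSSolutionOn.exists_norm_le_of_sobolevDatum`),
and the stability bound computed with `M' = M + 1`,

  `Φ := 2 (D + 4 ν^{-3/4} T^{1/4} G₂') · exp (36 C₀² (2M + 1)² T / ν) ≤ 1/2`,

is small, then `u'` IS bounded by `M + 1` on the whole slab and
`‖u'(t,x) − u(t,x)‖ ≤ 2 (D + 4 ν^{-3/4} T^{1/4} G₂') exp (36 C₀² (2M+1)² t / ν) ≤ 1/2` there
(`sup_stability_forced_free_bootstrap`, with the bound `norm_le_of_bootstrap`).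

Mechanism (Leray 1934, §19: continuity of the maximum velocity over the `L^∞` window; the
standard continuity / bootstrap argument of perturbation theory, e.g. Tao, *Nonlinear dispersive
equations*, Prop. 1.21): induction over a UNIFORM time step `δ`. If `‖u'‖ ≤ M + 1` on `[0, s]`,
the stability theorem gives `‖u' − u‖ ≤ Φ ≤ 1/2` there, so `‖u'(s)‖ ≤ M + 1/2`; Leray's forced
short-time bound from the base time `s` (`exists_norm_le_sup_add_sqrt_add_force`, which uses the
qualitative bound of `u'` only inside the `O(√(t − s))` Duhamel term) keeps `‖u'‖ ≤ M + 1` on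
`[s, s + δ]` with `δ` depending on that qualitative bound, the force and `ν` alone — hence uniform
along the induction. No continuity of the sup norm in time is used.

Consumer: the FREE-RUN DOOR of the cell `ns-blowup` (route `PalasekTowerBreakdown`, crux
`EpisodeBase`, stmt-NavierStokesRegularity-19179): the perturbed (host-forced) run is compared
with the free run of a design without knowing its size in advance. LABEL: Literature port (a-priori
estimate for GIVEN solutions). WHAT THIS IS NOT: not a statement about Navier–Stokes regularity or
blow-up — both solutions are assumed classical on the fixed slab.

## Mathlib / tree search

Tree: `sup_stability_forced_free` (`ClassicalSupStabilityForced`, this seat);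
`exists_norm_le_sup_add_sqrt_add_force` (`ForcedOseenRepresentationClassical`);
`IsClassicalNSSolutionOn.comp_add_right`, `IsClassicalNSSolutionOn.mono` (`ClassicalSolutionGlue`,
`ClassicalSolution`). No bootstrap form of a sup-norm stability estimate existed
(`lean search 'bootstrap|stability' --decl` in FluidPDE: Kato/KNSS bootstrap levels for mild
solutions only).

## References

* J. Leray, Acta Math. 63 (1934), §19 (3.4)–(3.8), §21 (3.15). [Leray1934]
* P. G. Lemarié-Rieusset, *The Navier–Stokes Problem in the 21st Century*, CRC Press 2016, Thm. 6.1
  (6.12), Thm. 11.2 (11.11). [LemarieRieusset2016]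
* T. Tao, *Nonlinear Dispersive Equations: Local and Global Analysis*, CBMS 106 (2006), Prop. 1.21
  (abstract bootstrap / continuity principle). [Tao2006Dispersive]
-/

noncomputable section

open MeasureTheory Set Function Filter
open _root_.Topology
open scoped ENNReal NNReal

namespace Literature.Analysis.FluidPDE

section Bootstrap

variable {ν T M D B : ℝ}
  {g' u u' : ℝ → EuclideanSpace ℝ (Fin 3) → EuclideanSpace ℝ (Fin 3)}
  {p p' : ℝ → EuclideanSpace ℝ (Fin 3) → ℝ} {G' G₂r : ℝ}

/-- **Bootstrap form of the sup-norm stability estimate.** Let `(u, p)` be an UNFORCED classical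
solution on `[0, T] × ℝ³` (`ν > 0`, `T > 0`) with finite energy and `‖u‖ ≤ M` (`M > 0`), and
`(u', p')` a classical solution FORCED by `g'` (jointly continuous, bounded, weakly divergence-free
slices with `‖g'(τ)‖₂ ≤ G₂'`) with finite energy and bounded by SOME `B` on the slab, with
`‖u'(0,·) − u(0,·)‖ ≤ D`. If the stability bound at `M' = M + 1` is small,
`2 (D + 4 ν^{-3/4} T^{1/4} G₂') exp (36 C₀² (2M+1)² T / ν) ≤ 1/2`, then for all `t ∈ [0, T]`
and all `x`: `‖u'(t,x) − u(t,x)‖ ≤ 2 (D + 4 ν^{-3/4} T^{1/4} G₂') exp (36 C₀² (2M+1)² t / ν)`.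
[cite: Leray1934, §19 (3.4)–(3.8)] [cite: LemarieRieusset2016, Thm. 11.2 (11.11) with Thm. 6.1]
[cite: Tao2006Dispersive, Prop. 1.21] -/
theorem sup_stability_forced_free_bootstrap (hν : 0 < ν) (hT : 0 < T)
    (hcl : IsClassicalNSSolutionOn (Icc 0 T) ν 0 u p)
    (hcl' : IsClassicalNSSolutionOn (Icc 0 T) ν g' u' p')
    (hg'c : Continuous (uncurry g'))
    (hG' : ∀ τ ∈ Icc 0 T, ∀ y, ‖g' τ y‖ ≤ G')
    (hg'div : ∀ τ ∈ Icc 0 T, IsWeaklyDivFree (g' τ)) (hG₂r : 0 ≤ G₂r)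
    (hg'2 : ∀ τ ∈ Icc 0 T, eLpNorm (g' τ) 2 volume ≤ ENNReal.ofReal G₂r)
    (hE : ∃ C : ℝ≥0∞, C < ⊤ ∧ ∀ t ∈ Icc 0 T, ∫⁻ x, ‖u t x‖ₑ ^ 2 ≤ C)
    (hE' : ∃ C : ℝ≥0∞, C < ⊤ ∧ ∀ t ∈ Icc 0 T, ∫⁻ x, ‖u' t x‖ₑ ^ 2 ≤ C)
    (hM : 0 < M) (hbd : ∀ t ∈ Icc 0 T, ∀ y, ‖u t y‖ ≤ M)
    (hbd' : ∀ t ∈ Icc 0 T, ∀ y, ‖u' t y‖ ≤ B)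
    (hD : ∀ y, ‖u' 0 y - u 0 y‖ ≤ D)
    (hΦ : 2 * (D + 4 * ν ^ (-(3 / 4 : ℝ)) * T ^ (1 / 4 : ℝ) * G₂r) *
      Real.exp (36 * oseenSliceConst (EuclideanSpace ℝ (Fin 3)) ^ 2 * (M + (M + 1)) ^ 2 / ν * T) ≤
        1 / 2) :
    ∀ t ∈ Icc 0 T, ∀ x, ‖u' t x - u t x‖ ≤
      2 * (D + 4 * ν ^ (-(3 / 4 : ℝ)) * T ^ (1 / 4 : ℝ) * G₂r) *
        Real.exp (36 * oseenSliceConst (EuclideanSpace ℝ (Fin 3)) ^ 2 * (M + (M + 1)) ^ 2 / ν * t) := by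
  -- ### constants
  obtain ⟨CB, hCB, hmin⟩ := exists_norm_le_sup_add_sqrt_add_force
  set C₀ : ℝ := oseenSliceConst (EuclideanSpace ℝ (Fin 3)) with hC₀def
  set lam : ℝ := 36 * C₀ ^ 2 * (M + (M + 1)) ^ 2 / ν with hlam_def
  have hlam0 : 0 ≤ lam := by positivity
  have hD0 : 0 ≤ D := (norm_nonneg _).trans (hD 0)
  set F : ℝ := 4 * ν ^ (-(3 / 4 : ℝ)) * T ^ (1 / 4 : ℝ) * G₂r with hF_def
  have hF0 : 0 ≤ F := by positivity
  have hexp1 : 1 ≤ Real.exp (lam * T) := Real.one_le_exp (by positivity)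
  -- `D ≤ 1/4` and the stability bound is `≤ 1/2` at every `t ≤ T`
  have hD4 : D ≤ 1 / 4 := by
    have h1 : 2 * (D + F) * 1 ≤ 2 * (D + F) * Real.exp (lam * T) :=
      mul_le_mul_of_nonneg_left hexp1 (by positivity)
    nlinarith
  have hΦt : ∀ t ∈ Icc 0 T, 2 * (D + F) * Real.exp (lam * t) ≤ 1 / 2 := by
    intro t ht
    have h1 : Real.exp (lam * t) ≤ Real.exp (lam * T) := Real.exp_le_exp.2 (by nlinarith [ht.2])
    exact (mul_le_mul_of_nonneg_left h1 (by positivity)).trans hΦ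
  -- the qualitative bound of `u'`, made positive
  set B₁ : ℝ := max B 1 with hB₁
  have hB₁pos : 0 < B₁ := lt_of_lt_of_le one_pos (le_max_right _ _)
  have hbd₁ : ∀ t ∈ Icc 0 T, ∀ y, ‖u' t y‖ ≤ B₁ := fun t ht y => (hbd' t ht y).trans (le_max_left _ _)
  -- the force bound, made nonnegative
  set G₁ : ℝ := max G' 0 with hG₁
  have hG₁0 : 0 ≤ G₁ := le_max_right _ _
  have hG₁b : ∀ τ ∈ Icc 0 T, ∀ y, ‖g' τ y‖ ≤ G₁ := fun τ hτ y => (hG' τ hτ y).trans (le_max_left _ _)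
  -- ### the uniform step
  set δ : ℝ := min (ν / (8 * CB * B₁ ^ 2) ^ 2) (1 / (4 * (G₁ + 1))) with hδ_def
  have hδpos : 0 < δ := lt_min (by positivity) (by positivity)
  -- the short-time increments are `≤ 1/4` each for `0 < τ ≤ δ`
  have hstep : ∀ τ : ℝ, 0 < τ → τ ≤ δ →
      CB * B₁ ^ 2 * ν ^ (-(1 / 2 : ℝ)) * (2 * Real.sqrt τ) ≤ 1 / 4 ∧ τ * G₁ ≤ 1 / 4 := by
    intro τ hτ0 hτδ
    constructor
    · have hτ1 : τ ≤ ν / (8 * CB * B₁ ^ 2) ^ 2 := hτδ.trans (min_le_left _ _)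
      have hsq : Real.sqrt τ ≤ Real.sqrt ν / (8 * CB * B₁ ^ 2) := by
        rw [← Real.sqrt_sq (by positivity : (0 : ℝ) ≤ 8 * CB * B₁ ^ 2), ← Real.sqrt_div' _ (sq_nonneg _)]
        exact Real.sqrt_le_sqrt hτ1
      have hν12 : ν ^ (-(1 / 2 : ℝ)) = (Real.sqrt ν)⁻¹ := by
        rw [Real.rpow_neg hν.le, Real.sqrt_eq_rpow]
      have hsν : 0 < Real.sqrt ν := Real.sqrt_pos.2 hν
      rw [hν12]
      calc CB * B₁ ^ 2 * (Real.sqrt ν)⁻¹ * (2 * Real.sqrt τ)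
          ≤ CB * B₁ ^ 2 * (Real.sqrt ν)⁻¹ * (2 * (Real.sqrt ν / (8 * CB * B₁ ^ 2))) := by
            gcongr
        _ = 1 / 4 := by field_simp; ring
    · have hτ2 : τ ≤ 1 / (4 * (G₁ + 1)) := hτδ.trans (min_le_right _ _)
      calc τ * G₁ ≤ 1 / (4 * (G₁ + 1)) * G₁ := mul_le_mul_of_nonneg_right hτ2 hG₁0
        _ ≤ 1 / 4 := by
            rw [div_mul_eq_mul_div, div_le_iff₀ (by positivity)]
            nlinarith
  -- ### restriction of all data to a sub-slab `[0, s]`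
  have restrict : ∀ s : ℝ, 0 < s → s ≤ T → (∀ t ∈ Icc 0 s, ∀ y, ‖u' t y‖ ≤ M + 1) →
      ∀ t ∈ Icc 0 s, ∀ x, ‖u' t x - u t x‖ ≤ 2 * (D + F) * Real.exp (lam * t) := by
    intro s hs0 hsT hbs
    have hsub : Icc 0 s ⊆ Icc 0 T := Icc_subset_Icc le_rfl hsT
    have hcls : IsClassicalNSSolutionOn (Icc 0 s) ν 0 u p := hcl.mono hsub (uniqueDiffOn_Icc hs0)
    have hcls' : IsClassicalNSSolutionOn (Icc 0 s) ν g' u' p' := hcl'.mono hsub (uniqueDiffOn_Icc hs0)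
    have hEs : ∃ C : ℝ≥0∞, C < ⊤ ∧ ∀ t ∈ Icc 0 s, ∫⁻ x, ‖u t x‖ₑ ^ 2 ≤ C := by
      obtain ⟨C, hC, hb⟩ := hE; exact ⟨C, hC, fun t ht => hb t (hsub ht)⟩
    have hEs' : ∃ C : ℝ≥0∞, C < ⊤ ∧ ∀ t ∈ Icc 0 s, ∫⁻ x, ‖u' t x‖ₑ ^ 2 ≤ C := by
      obtain ⟨C, hC, hb⟩ := hE'; exact ⟨C, hC, fun t ht => hb t (hsub ht)⟩
    have key := sup_stability_forced_free hν hs0 hcls hcls' hg'c (fun τ hτ => hG' τ (hsub hτ))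
      (fun τ hτ => hg'div τ (hsub hτ)) hG₂r (fun τ hτ => hg'2 τ (hsub hτ)) hEs hEs' hM
      (by linarith : 0 < M + 1) (fun t ht => hbd t (hsub ht)) hbs hD
    intro t ht x
    refine (key t ht x).trans ?_
    have hs4 : s ^ (1 / 4 : ℝ) ≤ T ^ (1 / 4 : ℝ) := Real.rpow_le_rpow hs0.le hsT (by norm_num)
    have hFs : 4 * ν ^ (-(3 / 4 : ℝ)) * s ^ (1 / 4 : ℝ) * G₂r ≤ F := by
      rw [hF_def]; gcongr
    have hlam_t : 36 * oseenSliceConst (EuclideanSpace ℝ (Fin 3)) ^ 2 * (M + (M + 1)) ^ 2 / ν * t =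
        lam * t := by rw [hlam_def]
    rw [hlam_t]
    gcongr
  -- ### Leray's forced short-time bound from a base time `s` where `‖u'(s)‖ ≤ M + 1/2`
  have advance : ∀ s : ℝ, 0 ≤ s → s < T → (∀ y, ‖u' s y‖ ≤ M + 1 / 2) →
      ∀ t ∈ Icc s T, t - s ≤ δ → ∀ x, ‖u' t x‖ ≤ M + 1 := by
    intro s hs0 hsT hbase t ht htδ x
    rcases ht.1.eq_or_lt with heq | hst
    · rw [← heq]; linarith [hbase x]
    -- the translate by `s`
    have hTs : 0 < T - s := by linarith
    have hcl'' : IsClassicalNSSolutionOn (Icc 0 (T - s)) ν (fun τ => g' (τ + s))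
        (fun τ => u' (τ + s)) (fun τ => p' (τ + s)) :=
      (hcl'.comp_add_right s).mono (fun τ hτ => ⟨by linarith [hτ.1], by linarith [hτ.2]⟩)
        (uniqueDiffOn_Icc hTs)
    have hg''c : Continuous (uncurry fun τ => g' (τ + s)) :=
      hg'c.comp ((continuous_fst.add continuous_const).prodMk continuous_snd)
    have hG'' : ∀ τ ∈ Icc 0 (T - s), ∀ y, ‖(fun τ => g' (τ + s)) τ y‖ ≤ G₁ := fun τ hτ y =>
      hG₁b (τ + s) ⟨by linarith [hτ.1], by linarith [hτ.2]⟩ y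
    have hg''div : ∀ τ ∈ Icc 0 (T - s), IsWeaklyDivFree ((fun τ => g' (τ + s)) τ) := fun τ hτ =>
      hg'div (τ + s) ⟨by linarith [hτ.1], by linarith [hτ.2]⟩
    have hg''2 : ∀ τ ∈ Icc 0 (T - s), eLpNorm ((fun τ => g' (τ + s)) τ) 2 volume ≤ ENNReal.ofReal G₂r :=
      fun τ hτ => hg'2 (τ + s) ⟨by linarith [hτ.1], by linarith [hτ.2]⟩
    have hE'' : ∃ C : ℝ≥0∞, C < ⊤ ∧ ∀ τ ∈ Icc 0 (T - s), ∫⁻ x, ‖(fun τ => u' (τ + s)) τ x‖ₑ ^ 2 ≤ C := by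
      obtain ⟨C, hC, hb⟩ := hE'
      exact ⟨C, hC, fun τ hτ => hb (τ + s) ⟨by linarith [hτ.1], by linarith [hτ.2]⟩⟩
    have hbd'' : ∀ τ ∈ Icc 0 (T - s), ∀ y, ‖(fun τ => u' (τ + s)) τ y‖ ≤ B₁ := fun τ hτ y =>
      hbd₁ (τ + s) ⟨by linarith [hτ.1], by linarith [hτ.2]⟩ y
    have hA : ∀ y, ‖(fun τ => u' (τ + s)) 0 y‖ ≤ M + 1 / 2 := fun y => by
      simpa using hbase y
    have hτI : t - s ∈ Ioc 0 (T - s) := ⟨by linarith, by linarith [ht.2]⟩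
    have key := hmin hν hTs hcl'' hg''c hG'' hg''div ENNReal.ofReal_ne_top hg''2 hE'' hB₁pos hbd'' hA
      (t - s) hτI x
    have hts : t - s + s = t := by ring
    simp only [hts] at key
    obtain ⟨h1, h2⟩ := hstep (t - s) (by linarith) htδ
    have h1' : CB * B₁ ^ 2 * ν ^ (-(1 / 2 : ℝ)) * (2 * Real.sqrt (t - s)) ≤ 1 / 4 := h1
    linarith
  -- ### the induction over the uniform step
  have induct : ∀ n : ℕ, ∀ t ∈ Icc 0 T, t ≤ (n : ℝ) * δ → ∀ y, ‖u' t y‖ ≤ M + 1 := by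
    intro n
    induction n with
    | zero =>
      intro t ht htn y
      have ht0 : t = 0 := le_antisymm (by simpa using htn) ht.1
      rw [ht0]
      have h := hD y
      have h2 : ‖u' 0 y‖ ≤ ‖u 0 y‖ + ‖u' 0 y - u 0 y‖ := by
        calc ‖u' 0 y‖ = ‖u 0 y + (u' 0 y - u 0 y)‖ := by rw [add_sub_cancel]
          _ ≤ ‖u 0 y‖ + ‖u' 0 y - u 0 y‖ := norm_add_le _ _
      linarith [hbd 0 ⟨le_rfl, hT.le⟩ y]
    | succ n ih =>
      intro t ht htn y
      -- the base time of this step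
      set s : ℝ := min ((n : ℝ) * δ) T with hs_def
      have hs0 : 0 ≤ s := le_min (by positivity) hT.le
      have hsT : s ≤ T := min_le_right _ _
      by_cases hts : t ≤ s
      · exact ih t ht (hts.trans (min_le_left _ _)) y
      rw [not_le] at hts
      -- here `s = n δ < t ≤ (n+1) δ`, in particular `s < T`
      have hsn : s = (n : ℝ) * δ := by
        rcases le_total ((n : ℝ) * δ) T with h | h
        · exact min_eq_left h
        · exfalso
          have : T ≤ s := le_min h le_rfl
          linarith [ht.2]
      have hsltT : s < T := lt_of_lt_of_le hts ht.2
      -- sup bound `M + 1` on `[0, s]`, hence `M + 1/2` at `s`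
      have hbs : ∀ τ ∈ Icc 0 s, ∀ z, ‖u' τ z‖ ≤ M + 1 := fun τ hτ z =>
        ih τ ⟨hτ.1, hτ.2.trans hsT⟩ (hτ.2.trans (min_le_left _ _)) z
      have hbase : ∀ z, ‖u' s z‖ ≤ M + 1 / 2 := by
        intro z
        rcases hs0.eq_or_lt with hs00 | hspos
        · rw [← hs00]
          have h2 : ‖u' 0 z‖ ≤ ‖u 0 z‖ + ‖u' 0 z - u 0 z‖ := by
            calc ‖u' 0 z‖ = ‖u 0 z + (u' 0 z - u 0 z)‖ := by rw [add_sub_cancel]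
              _ ≤ ‖u 0 z‖ + ‖u' 0 z - u 0 z‖ := norm_add_le _ _
          linarith [hbd 0 ⟨le_rfl, hT.le⟩ z, hD z]
        · have hw := restrict s hspos hsT hbs s ⟨hs0, le_rfl⟩ z
          have hΦs := hΦt s ⟨hs0, hsT⟩
          have h2 : ‖u' s z‖ ≤ ‖u s z‖ + ‖u' s z - u s z‖ := by
            calc ‖u' s z‖ = ‖u s z + (u' s z - u s z)‖ := by rw [add_sub_cancel]
              _ ≤ ‖u s z‖ + ‖u' s z - u s z‖ := norm_add_le _ _
          linarith [hbd s ⟨hs0, hsT⟩ z]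
      refine advance s hs0 hsltT hbase t ⟨hts.le, ht.2⟩ ?_ y
      push_cast at htn
      rw [hsn]; linarith
  -- ### conclusion
  obtain ⟨n, hn⟩ := exists_nat_ge (T / δ)
  have hall : ∀ t ∈ Icc 0 T, ∀ y, ‖u' t y‖ ≤ M + 1 := by
    intro t ht y
    refine induct n t ht ?_ y
    have : T ≤ (n : ℝ) * δ := by rwa [div_le_iff₀ hδpos] at hn
    exact ht.2.trans this
  intro t ht x
  have h := restrict T hT le_rfl hall t ht x
  have hlam_t : 36 * oseenSliceConst (EuclideanSpace ℝ (Fin 3)) ^ 2 * (M + (M + 1)) ^ 2 / ν * t =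
      lam * t := by rw [hlam_def]
  rw [hlam_t]
  exact h

/-- **The bootstrap bound**: under the hypotheses of `sup_stability_forced_free_bootstrap`, the
forced solution stays within `1/2` of the reference solution, `‖u'(t,x) − u(t,x)‖ ≤ 1/2`, and is
bounded by `M + 1/2` on the whole slab. [cite: Leray1934, §19 (3.4)–(3.8)]
[cite: Tao2006Dispersive, Prop. 1.21] -/
theorem norm_le_of_bootstrap (hν : 0 < ν) (hT : 0 < T)
    (hcl : IsClassicalNSSolutionOn (Icc 0 T) ν 0 u p)
    (hcl' : IsClassicalNSSolutionOn (Icc 0 T) ν g' u' p')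
    (hg'c : Continuous (uncurry g'))
    (hG' : ∀ τ ∈ Icc 0 T, ∀ y, ‖g' τ y‖ ≤ G')
    (hg'div : ∀ τ ∈ Icc 0 T, IsWeaklyDivFree (g' τ)) (hG₂r : 0 ≤ G₂r)
    (hg'2 : ∀ τ ∈ Icc 0 T, eLpNorm (g' τ) 2 volume ≤ ENNReal.ofReal G₂r)
    (hE : ∃ C : ℝ≥0∞, C < ⊤ ∧ ∀ t ∈ Icc 0 T, ∫⁻ x, ‖u t x‖ₑ ^ 2 ≤ C)
    (hE' : ∃ C : ℝ≥0∞, C < ⊤ ∧ ∀ t ∈ Icc 0 T, ∫⁻ x, ‖u' t x‖ₑ ^ 2 ≤ C)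
    (hM : 0 < M) (hbd : ∀ t ∈ Icc 0 T, ∀ y, ‖u t y‖ ≤ M)
    (hbd' : ∀ t ∈ Icc 0 T, ∀ y, ‖u' t y‖ ≤ B)
    (hD : ∀ y, ‖u' 0 y - u 0 y‖ ≤ D)
    (hΦ : 2 * (D + 4 * ν ^ (-(3 / 4 : ℝ)) * T ^ (1 / 4 : ℝ) * G₂r) *
      Real.exp (36 * oseenSliceConst (EuclideanSpace ℝ (Fin 3)) ^ 2 * (M + (M + 1)) ^ 2 / ν * T) ≤
        1 / 2) :
    ∀ t ∈ Icc 0 T, ∀ x, ‖u' t x - u t x‖ ≤ 1 / 2 ∧ ‖u' t x‖ ≤ M + 1 / 2 := by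
  intro t ht x
  have h := sup_stability_forced_free_bootstrap hν hT hcl hcl' hg'c hG' hg'div hG₂r hg'2 hE hE' hM hbd
    hbd' hD hΦ t ht x
  have hD0 : 0 ≤ D := (norm_nonneg _).trans (hD 0)
  have h1 : Real.exp (36 * oseenSliceConst (EuclideanSpace ℝ (Fin 3)) ^ 2 * (M + (M + 1)) ^ 2 / ν * t) ≤
      Real.exp (36 * oseenSliceConst (EuclideanSpace ℝ (Fin 3)) ^ 2 * (M + (M + 1)) ^ 2 / ν * T) :=
    Real.exp_le_exp.2 (mul_le_mul_of_nonneg_left ht.2 (by positivity))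
  have hw : ‖u' t x - u t x‖ ≤ 1 / 2 :=
    h.trans ((mul_le_mul_of_nonneg_left h1 (by positivity)).trans hΦ)
  refine ⟨hw, ?_⟩
  calc ‖u' t x‖ = ‖u t x + (u' t x - u t x)‖ := by rw [add_sub_cancel]
    _ ≤ ‖u t x‖ + ‖u' t x - u t x‖ := norm_add_le _ _
    _ ≤ M + 1 / 2 := add_le_add (hbd t ht x) hw

end Bootstrap

end Literature.Analysis.FluidPDE

end
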